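import Summits.HodgeConjecture.CorCM.GaloisCyclicFourFactor
import HarnessLib

/-!
# Composita `K = M · L` with a Galois CM field `L`: EQUIDISTRIBUTED FIBRES are degenerate; `Gal(K/ℚ) ≅ Q₈ × C₄`
# is BAD for every complex conjugation (order-32 census #15 complete)

COR-CM (cell `pub-hodgecm2`), binder seat b04 (gen 23), count-neutral claim CYCLIC-BY-MULTIPLIERS, part IX (blanket
NAME ACK `CorCM/GaloisCy*`, HOME/INBOX l.9773).  HC_CM is NOT proved here; these are unconditional negative-side
examples (simple CM abelian varieties whose powers carry exceptional Hodge classes).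

Setting.  `Gal(K/ℚ) ≅ H × Γ` with complex conjugation `(c₀, c₁)`, `c₁ ≠ 1`: equivalently `K = M · L` with
`L = K^H` a Galois CM field of group `Γ` (complex conjugation `c₁`) and `M = K^Γ` Galois of group `H`, linearly
disjoint (`M` totally real iff `c₀ = 1`).  A CM set `T ⊆ H × Γ` is the same as a family `τ : H → {CM sets of (Γ, c₁)}` (its fibres
`τ(q) = {v : (q, v) ∈ T}`).

THE CRITERION (`exists_simple_degenerate_of_model_fibres`).  If every `v ∈ Γ` lies in exactly half of the fibres,
`#{q : v ∈ τ(q)} = |H|/2`, then the set `D = H × {1}` is BALANCED for `T` in the sense of gen 20's certificate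
(`exists_simple_degenerate_of_model_balanced`): `#{x ∈ D : x g ∈ T} = #{q : (q q₀, v) ∈ T} = |H|/2 = |D|/2` for every
`g = (q₀, v)`, and `D` is not `c`-stable (`(c₀, c₁) ∉ D`).  Hence a PRIMITIVE type with equidistributed fibres gives a
SIMPLE DEGENERATE abelian variety of dimension `|H||Γ|/2` with CM by `K`.  (Fourier picture: the block of the type at
the character `1_H ⊗ χ`, `χ` odd on `Γ`, is `Σ_q χ̂(τ(q))`, and for `Γ` cyclic of order `4` it vanishes iff the
fibres are equidistributed; for `Γ = C₂` — an imaginary quadratic subfield, gen 19 — the condition reads "half the signs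
are `+`".)

THE EXAMPLE (`exists_simple_degenerate_of_quaternion_cyclicFour_compositum`).  `H = Q₈`, `A = C₄`, `c = (1, 2)`:
`K` is the compositum of a totally real `Q₈`-field and a cyclic quartic CM field.  With the length-2 intervals
`τ(1) = {0,1}`, `τ(−1) = {2,3}`, `τ(±i) = {1,2}`, `τ(k) = {1,2}`, `τ(±j) = τ(−k) = {3,0}` (Mathlib coordinates:
`i = a 1`, `j = xa 0`, `k = xa 3`) the type is primitive, every `v ∈ ℤ/4` lies in exactly `4` fibres, and the
`B`-rank is `9 < 17` (seat folder `scratch/g23g.py`); dimension `16`.  The third central involution `(a², 2)`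
(compositum of a `Q₈`-CM field and a cyclic quartic CM field) falls the same way
(`exists_simple_degenerate_of_quaternion_cyclicFour_compositum'`, fibres again equidistributed, `B`-rank `9`,
`scratch/g23h.py`), and with part VIII (`c = (a², 0)`) the group is settled outright:
**`Gal(K/ℚ) ≅ Q₈ × C₄` ⟹ BAD, whatever the complex conjugation** (`exists_simple_degenerate_of_mulEquiv_quaternion_cyclicFour`;
order-32 census #15 complete).

References: Shimura, *Abelian varieties with complex multiplication and modular functions* (1998), §6.2 Thm. 3,
§8.2 Prop. 26 [cite: Shimura1998]; B. Gordon, *A survey of the Hodge conjecture for abelian varieties* (1999), Thm. 6.4,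
§9 [cite: Gordon1999HodgeAVSurvey].
-/

noncomputable section

open CategoryTheory CategoryTheory.Limits NumberField
open scoped BigOperators

namespace Summit.HodgeConjecture.CorCM.GaloisModels

open Literature.NumberTheory.ComplexMultiplication
open Literature.AlgebraicGeometry.Motives (AbelianVariety CMType)
open Literature.AlgebraicGeometry.HodgeTheory
open Literature.AlgebraicGeometry.ComplexMultiplication (IsCMTypeRealisation)
open Literature.AlgebraicGeometry.Pohlmann1968
open Literature.Barriers.HodgeConjecture (divisorClassesSpan)

section Fibres

variable {H Γ : Type*} [Group H] [Fintype H] [DecidableEq H] [Group Γ] [Fintype Γ] [DecidableEq Γ]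
variable {K : Type} [Field K] [NumberField K] [IsCMField K] [IsGalois ℚ K]

/-- **EQUIDISTRIBUTED FIBRES ARE DEGENERATE.**  `Gal(K/ℚ) ≅ H × Γ` with complex conjugation `(c₀, c₁)`, `c₁ ≠ 1`
(`K = M·L`, `L = K^H` a Galois CM field with group `Γ`, `M = K^Γ` Galois with group `H`, totally real iff `c₀ = 1`);
a family `τ : H → Finset Γ` whose total set `T = {(q, v) : v ∈ τ q}` is a primitive CM set and in which every
`v ∈ Γ` lies in exactly `|H|/2` fibres yields a SIMPLE DEGENERATE abelian variety of dimension `|H||Γ|/2` with CM by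
`K` (balanced set `H × {1}`).
[cite: Shimura1998, §6.2 Thm. 3 and §8.2 Prop. 26] [cite: Gordon1999HodgeAVSurvey, Thm. 6.4 and §9.3] -/
theorem exists_simple_degenerate_of_model_fibres (e : (K ≃ₐ[ℚ] K) ≃* H × Γ) (c₀ : H) (c₁ : Γ)
    (hc : e ((IsCMField.complexConj K).restrictScalars ℚ) = (c₀, c₁)) (hc1 : c₁ ≠ 1) (τ : H → Finset Γ)
    (hcm : ∀ q v, v ∈ τ q ↔ c₁ * v ∉ τ (c₀ * q))
    (hprim : ∀ y : H × Γ, y ≠ 1 → ∃ q v, ¬ (v ∈ τ q ↔ y.2 * v ∈ τ (y.1 * q)))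
    (hfib : ∀ v : Γ, 2 * (Finset.univ.filter fun q : H => v ∈ τ q).card = Fintype.card H) :
    ∃ (Φ : CMType K) (φ₀ : K →+* ℂ) (A : AbelianVariety ℂ) (ι : 𝓞 K →+* End A)
      (θ : K →+* Module.End ℂ (complexBetti A.X 1)),
      IsPrimitive (ℂ ≃+* ℂ) Φ.1 φ₀ ∧ ¬ IsNondegenerate Φ ∧ IsCMTypeRealisation Φ A ι θ ∧ A.IsSimple ∧
      A.dim = Fintype.card H * Fintype.card Γ / 2 ∧
      ∃ n p : ℕ, ∃ x : complexBetti (⨁ fun _ : Fin n => A).X (2 * p), IsRationalClass x ∧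
        IsOfHodgeType (⨁ fun _ : Fin n => A).dim (⨁ fun _ : Fin n => A).X (2 * p) p p x ∧
        x ∉ divisorClassesSpan (⨁ fun _ : Fin n => A).X (⨁ fun _ : Fin n => A).dim p := by
  classical
  set T : Finset (H × Γ) := Finset.univ.filter fun p => p.2 ∈ τ p.1 with hT_def
  have hT : ∀ p : H × Γ, p ∈ T ↔ p.2 ∈ τ p.1 := fun p => by simp [hT_def]
  have hmain := exists_simple_degenerate_of_model_balanced e (c₀, c₁) hc T
    (fun p => by
      obtain ⟨q, v⟩ := p
      rw [hT, hT, Prod.mk_mul_mk]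
      exact hcm q v)
    (fun y hy => by
      obtain ⟨q, v, hqv⟩ := hprim y hy
      refine ⟨(q, v), ?_⟩
      obtain ⟨a, b⟩ := y
      rwa [hT, hT, Prod.mk_mul_mk])
    ((Finset.univ : Finset H) ×ˢ ({(1 : Γ)} : Finset Γ))
    (fun g => by
      obtain ⟨q₀, v⟩ := g
      rw [Finset.card_product, Finset.card_singleton, mul_one, Finset.card_univ, ← hfib v]
      congr 1
      refine Finset.card_bij' (fun x _ => x.1 * q₀) (fun q _ => (q * q₀⁻¹, 1)) ?_ ?_ ?_ ?_
      · intro x hx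
        simp only [Finset.mem_filter, Finset.mem_product, Finset.mem_univ, Finset.mem_singleton, true_and] at hx ⊢
        obtain ⟨hx1, hx2⟩ := hx
        rw [show x = (x.1, (1 : Γ)) from Prod.ext rfl hx1, Prod.mk_mul_mk, one_mul, hT] at hx2
        exact hx2
      · intro q hq
        simp only [Finset.mem_filter, Finset.mem_product, Finset.mem_univ, Finset.mem_singleton, true_and] at hq ⊢
        rw [Prod.mk_mul_mk, one_mul, inv_mul_cancel_right, hT]
        exact hq
      · intro x hx
        simp only [Finset.mem_filter, Finset.mem_product, Finset.mem_univ, Finset.mem_singleton, true_and] at hx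
        exact Prod.ext (mul_inv_cancel_right x.1 q₀) hx.1.symm
      · intro q _
        exact inv_mul_cancel_right q q₀)
    ⟨((1 : H), (1 : Γ)), by simp, by
      rw [Prod.mk_mul_mk, mul_one, mul_one, Finset.mem_product, Finset.mem_singleton]
      exact fun h => hc1 h.2⟩
  rwa [Fintype.card_prod] at hmain

end Fibres

section Quaternion

open QuaternionGroup

variable {K : Type} [Field K] [NumberField K] [IsCMField K] [IsGalois ℚ K]

/-- **`Gal(K/ℚ) ≅ Q₈ × C₄` with complex conjugation `(1, 2)` — `K` = (totally real `Q₈`-field) · (cyclic quartic CM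
field): a simple DEGENERATE abelian `16`-fold with CM by `K`** (order-32 census #15, second central involution; the
interval family `τ(1) = {0,1}`, `τ(a²) = {2,3}`, `τ(a^{±1}) = τ(xa 3) = {1,2}`, `τ(xa 0) = τ(xa 2) = τ(xa 1) = {3,0}`;
balanced set `Q₈ × {0}`; `B`-rank `9 < 17`). [cite: Shimura1998, §6.2 Thm. 3 and §8.2 Prop. 26]
[cite: Gordon1999HodgeAVSurvey, Thm. 6.4] -/
theorem exists_simple_degenerate_of_quaternion_cyclicFour_compositum
    (e : (K ≃ₐ[ℚ] K) ≃* QuaternionGroup 2 × Multiplicative (ZMod 4))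
    (hc : e ((IsCMField.complexConj K).restrictScalars ℚ) = (a 0, Multiplicative.ofAdd 2)) :
    ∃ (Φ : CMType K) (φ₀ : K →+* ℂ) (A : AbelianVariety ℂ) (ι : 𝓞 K →+* End A)
      (θ : K →+* Module.End ℂ (complexBetti A.X 1)),
      IsPrimitive (ℂ ≃+* ℂ) Φ.1 φ₀ ∧ ¬ IsNondegenerate Φ ∧ IsCMTypeRealisation Φ A ι θ ∧ A.IsSimple ∧
      A.dim = 16 ∧
      ∃ n p : ℕ, ∃ x : complexBetti (⨁ fun _ : Fin n => A).X (2 * p), IsRationalClass x ∧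
        IsOfHodgeType (⨁ fun _ : Fin n => A).dim (⨁ fun _ : Fin n => A).X (2 * p) p p x ∧
        x ∉ divisorClassesSpan (⨁ fun _ : Fin n => A).X (⨁ fun _ : Fin n => A).dim p := by
  have h := exists_simple_degenerate_of_model_balanced e _ hc
    {(a 0, Multiplicative.ofAdd 0), (a 0, Multiplicative.ofAdd 1), (a 2, Multiplicative.ofAdd 2),
      (a 2, Multiplicative.ofAdd 3), (a 1, Multiplicative.ofAdd 1), (a 1, Multiplicative.ofAdd 2),
      (a 3, Multiplicative.ofAdd 1), (a 3, Multiplicative.ofAdd 2), (xa 0, Multiplicative.ofAdd 0),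
      (xa 0, Multiplicative.ofAdd 3), (xa 2, Multiplicative.ofAdd 0), (xa 2, Multiplicative.ofAdd 3),
      (xa 3, Multiplicative.ofAdd 1), (xa 3, Multiplicative.ofAdd 2), (xa 1, Multiplicative.ofAdd 0),
      (xa 1, Multiplicative.ofAdd 3)}
    (by decide) (by decide)
    {(a 0, Multiplicative.ofAdd 0), (a 1, Multiplicative.ofAdd 0), (a 2, Multiplicative.ofAdd 0),
      (a 3, Multiplicative.ofAdd 0), (xa 0, Multiplicative.ofAdd 0), (xa 1, Multiplicative.ofAdd 0),
      (xa 2, Multiplicative.ofAdd 0), (xa 3, Multiplicative.ofAdd 0)}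
    (by decide) (by decide)
  rwa [Fintype.card_prod, QuaternionGroup.card, Fintype.card_multiplicative, ZMod.card] at h

/-- **`Gal(K/ℚ) ≅ Q₈ × C₄` with complex conjugation `(a², 2)` — `K` = (`Q₈`-CM field) · (cyclic quartic CM field): a
simple DEGENERATE abelian `16`-fold with CM by `K`** (order-32 census #15, third central involution; fibres
`τ(1) = {0,2}`, `τ(a) = τ(a³) = {0,3}`, `τ(a²) = {1,3}`, `τ(xa 0) = τ(xa 2) = {1,2}`, `τ(xa 1) = {0,2}`, `τ(xa 3) = {1,3}`,
equidistributed; balanced set `Q₈ × {0}`; `B`-rank `9 < 17`). [cite: Shimura1998, §6.2 Thm. 3 and §8.2 Prop. 26]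
[cite: Gordon1999HodgeAVSurvey, Thm. 6.4] -/
theorem exists_simple_degenerate_of_quaternion_cyclicFour_compositum'
    (e : (K ≃ₐ[ℚ] K) ≃* QuaternionGroup 2 × Multiplicative (ZMod 4))
    (hc : e ((IsCMField.complexConj K).restrictScalars ℚ) = (a 2, Multiplicative.ofAdd 2)) :
    ∃ (Φ : CMType K) (φ₀ : K →+* ℂ) (A : AbelianVariety ℂ) (ι : 𝓞 K →+* End A)
      (θ : K →+* Module.End ℂ (complexBetti A.X 1)),
      IsPrimitive (ℂ ≃+* ℂ) Φ.1 φ₀ ∧ ¬ IsNondegenerate Φ ∧ IsCMTypeRealisation Φ A ι θ ∧ A.IsSimple ∧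
      A.dim = 16 ∧
      ∃ n p : ℕ, ∃ x : complexBetti (⨁ fun _ : Fin n => A).X (2 * p), IsRationalClass x ∧
        IsOfHodgeType (⨁ fun _ : Fin n => A).dim (⨁ fun _ : Fin n => A).X (2 * p) p p x ∧
        x ∉ divisorClassesSpan (⨁ fun _ : Fin n => A).X (⨁ fun _ : Fin n => A).dim p := by
  have h := exists_simple_degenerate_of_model_balanced e _ hc
    {(a 0, Multiplicative.ofAdd 0), (a 0, Multiplicative.ofAdd 2), (a 1, Multiplicative.ofAdd 0),
      (a 1, Multiplicative.ofAdd 3), (a 2, Multiplicative.ofAdd 1), (a 2, Multiplicative.ofAdd 3),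
      (a 3, Multiplicative.ofAdd 0), (a 3, Multiplicative.ofAdd 3), (xa 0, Multiplicative.ofAdd 1),
      (xa 0, Multiplicative.ofAdd 2), (xa 1, Multiplicative.ofAdd 0), (xa 1, Multiplicative.ofAdd 2),
      (xa 2, Multiplicative.ofAdd 1), (xa 2, Multiplicative.ofAdd 2), (xa 3, Multiplicative.ofAdd 1),
      (xa 3, Multiplicative.ofAdd 3)}
    (by decide) (by decide)
    {(a 0, Multiplicative.ofAdd 0), (a 1, Multiplicative.ofAdd 0), (a 2, Multiplicative.ofAdd 0),
      (a 3, Multiplicative.ofAdd 0), (xa 0, Multiplicative.ofAdd 0), (xa 1, Multiplicative.ofAdd 0),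
      (xa 2, Multiplicative.ofAdd 0), (xa 3, Multiplicative.ofAdd 0)}
    (by decide) (by decide)
  rwa [Fintype.card_prod, QuaternionGroup.card, Fintype.card_multiplicative, ZMod.card] at h

/-- The central elements of order `≤ 2` of `Q₈ × C₄`: `1`, `(a², 0)`, `(1, 2)`, `(a², 2)`. [folklore] -/
theorem central_involution_quaternion_cyclicFour : ∀ x : QuaternionGroup 2 × Multiplicative (ZMod 4),
    x * x = 1 → (∀ y, x * y = y * x) → x = 1 ∨ x = (a 2, Multiplicative.ofAdd 0) ∨
      x = (a 0, Multiplicative.ofAdd 2) ∨ x = (a 2, Multiplicative.ofAdd 2) := by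
  decide

/-- **`Gal(K/ℚ) ≅ Q₈ × C₄` is BAD, whatever the complex conjugation**: for each of the three central involutions
there is a simple DEGENERATE abelian `16`-fold with CM by `K` — `(a², 0)` by part VIII (the diagonal-`C₄` Weil type,
`exists_simple_degenerate_of_quaternion_cyclicFour`), `(1, 2)` and `(a², 2)` by equidistributed fibres.  Order-32
census #15 is thereby a theorem in all three columns. [cite: Shimura1998, §6.2 Thm. 3 and §8.2 Prop. 26]
[cite: Gordon1999HodgeAVSurvey, Thm. 6.4 and §9.3] -/
theorem exists_simple_degenerate_of_mulEquiv_quaternion_cyclicFour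
    (e : (K ≃ₐ[ℚ] K) ≃* QuaternionGroup 2 × Multiplicative (ZMod 4)) :
    ∃ (Φ : CMType K) (φ₀ : K →+* ℂ) (A : AbelianVariety ℂ) (ι : 𝓞 K →+* End A)
      (θ : K →+* Module.End ℂ (complexBetti A.X 1)),
      IsPrimitive (ℂ ≃+* ℂ) Φ.1 φ₀ ∧ ¬ IsNondegenerate Φ ∧ IsCMTypeRealisation Φ A ι θ ∧ A.IsSimple ∧
      A.dim = 16 ∧
      ∃ n p : ℕ, ∃ x : complexBetti (⨁ fun _ : Fin n => A).X (2 * p), IsRationalClass x ∧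
        IsOfHodgeType (⨁ fun _ : Fin n => A).dim (⨁ fun _ : Fin n => A).X (2 * p) p p x ∧
        x ∉ divisorClassesSpan (⨁ fun _ : Fin n => A).X (⨁ fun _ : Fin n => A).dim p := by
  rcases central_involution_quaternion_cyclicFour _ (GaloisRank.model_complexConj_mul_self e rfl)
      (fun y => GaloisRank.model_complexConj_comm e rfl y) with hc | hc | hc | hc
  · exact absurd hc (GaloisRank.model_complexConj_ne_one e rfl)
  · obtain ⟨Φ, φ₀, A, ι, θ, h1, h2, h3, h4, h5, h6⟩ :=
      exists_simple_degenerate_of_quaternion_cyclicFour (n := 2) (by norm_num) e hc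
    exact ⟨Φ, φ₀, A, ι, θ, h1, h2, h3, h4, by rw [h5], h6⟩
  · exact exists_simple_degenerate_of_quaternion_cyclicFour_compositum e hc
  · exact exists_simple_degenerate_of_quaternion_cyclicFour_compositum' e hc

end Quaternion

end Summit.HodgeConjecture.CorCM.GaloisModels
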